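import Summits.AtomisticToContinuum.HydrodynamicLimit.Theorems.CollisionIsometryCLTDiffuseBackwardInfluenceDefs
import Summits.AtomisticToContinuum.HydrodynamicLimit.Theorems.CollisionIsometryCLTTransferIsometry

/-!
# Row budget of the frozen-geometry velocity transfer after any number of fold steps
(registered stub `stub_rowBudgetN` of the crux `DiffuseBackwardInfluence`, stmt-AtomisticToContinuum-12950,
line `share-nondegeneracy-one-flight`)

`RowBudgetN σ`: for every `N`, configuration `y`, number `n` of fold steps and particle `i`,
`Σ_k a_ik(n) = Σ_k Σ_a ‖M(n) (e_k ⊗ e_a) i‖² = 3`, where `M(n) = transferN σ N y n` is the fold of the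
first `n` collision reflections of the Alexander construction at the realised pre-collisional positions.

Proof: `transferN σ N y n = (List.range n).foldl (step σ N y)`, and the landed support item
`TransferIsometry` (`Theorems/CollisionIsometryCLTTransferIsometry.lean`) proves that every such fold of the
crux's `dite`-guarded reflection steps is additive, homogeneous and `Σ_i ‖W i‖²`-preserving
(`TransferIsometry.foldl_l2_props`, `TransferIsometry.dite_collide_step_props`: `reflectVel` at a frozen
normal is a linear isometry of the velocity pair, the identity at normal `0`), and that every row of ANY
additive homogeneous `ℓ²`-isometry of `ι → ℝ^m` has weight `card m` (`TransferIsometry.rowWeight_eq_card`: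
a linear isometry of a finite-dimensional Hilbert space is unitary, so the scalar rows of its matrix are unit
vectors). With `m = Fin 3` this is `3`.
-/

namespace Summit.AtomisticToContinuum.HydrodynamicLimit.Theorems.DiffuseBackwardInfluenceShare

open scoped BigOperators
open Literature.Analysis.FluidPDE
open Summit.AtomisticToContinuum.HydrodynamicLimit.Theorems.DiffuseBackwardInfluenceNeg

noncomputable section

namespace RowBudget

/-- The transfer after `n` fold steps is additive, homogeneous and preserves `Σ_i ‖W i‖²`
(each fold step is the crux's `dite`-guarded elastic reflection of one genuine pair `h.some.1 < h.some.2`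
at frozen positions). [folklore] -/
theorem transferN_l2_props (σ : ℝ) (N : ℕ) (y : Cfg N) (n : ℕ) :
    (∀ W₁ W₂, transferN σ N y n (W₁ + W₂) = transferN σ N y n W₁ + transferN σ N y n W₂) ∧
      (∀ (c : ℝ) W, transferN σ N y n (c • W) = c • transferN σ N y n W) ∧
      (∀ W, ∑ i, ‖transferN σ N y n W i‖ ^ 2 = ∑ i, ‖W i‖ ^ 2) :=
  TransferIsometry.foldl_l2_props (step σ N y)
    (TransferIsometry.dite_collide_step_props (Torus.geometry (Fin 3)) (pairsAt σ N y)
      (fun k j => (pre σ N y k j).1)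
      (fun _ h => ne_of_lt (Alexander.mem_incomingPairs.1 h.some_mem).1))
    (List.range n)

/-- Row weight `3` of the transfer after `n` fold steps, in the `transferN` vocabulary. [folklore] -/
theorem rowWeight_transferN (σ : ℝ) (N : ℕ) (y : Cfg N) (n : ℕ) (i : Fin (N + 1)) :
    ∑ k : Fin (N + 1), ∑ a : Fin 3,
      ‖transferN σ N y n (Pi.single k (EuclideanSpace.single a (1 : ℝ))) i‖ ^ 2 = 3 := by
  obtain ⟨hadd, hsmul, hnorm⟩ := transferN_l2_props σ N y n
  have h := TransferIsometry.rowWeight_eq_card (transferN σ N y n) hadd hsmul hnorm i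
  rwa [Fintype.card_fin, Nat.cast_ofNat] at h

end RowBudget

/-- **ROW BUDGET** (registered stub `stub_rowBudgetN` of crux stmt-AtomisticToContinuum-12950, line
`share-nondegeneracy-one-flight`): after any number `n` of fold steps every block row of the frozen-geometry
transfer has Frobenius weight `Σ_k a_ik(n) = 3` — `M(n)` is a linear `ℓ²`-isometry, hence orthogonal. In tracer
language: the host of one influence tracer of a uniformly chosen source is exactly uniform. [folklore] -/
theorem stub_rowBudgetN : ∀ σ : ℝ, RowBudgetN σ :=
  fun σ N y n i => RowBudget.rowWeight_transferN σ N y n i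

end

end Summit.AtomisticToContinuum.HydrodynamicLimit.Theorems.DiffuseBackwardInfluenceShare
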